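import Summits.HodgeConjecture.HodgeConjecture.Theorems.GenericDivisibilityBounded.Negative.ArenaNonempty
import Summits.HodgeConjecture.HodgeConjecture.Theorems.GenericDivisibilityGenericDivisibilityBoundedLevelCleanFunnel

/-!
# `GenericDivisibilityBounded` (C2, stmt-HodgeConjecture-18467) · Negative · load-bearing hypotheses of
# the HEART `stub_finiteLevel` of line `finite-level-bootstrap`

Standing disprover, cdisprove gen-2 (refuter-cdisprove-stmt-HodgeConjecture-18467-g2-0, 2026-08-17),
line attack. The registered heart (`Sig.stub_finiteLevel`, `Cruxes/…/Lines/finite_level_bootstrap.lean`;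
open exactly off the sector `N¹H^{2p} = H^{2p}`) reads: for `p ≥ 2` and `X` a smooth projective complex
`2p`-fold, `∃ ℓ prime, s ≥ 1` such that every `z ∈ H^{2p}(X(ℂ);ℤ)` with
`D'(ℓ^s, z) := ∃ Z closed, Z ≠ univ, ∃ y, ∃ M ≥ 1, M • (z| - ℓ^s • y) = 0` has some `w` with
`z - ℓ • w ∈ GT` (generically torsion). With the open arena now INHABITED at `p = 2` (the fourfold
`(E_τ × E_τ)²` of `Negative/ArenaNonempty`, `N¹H⁴ ≠ H⁴`), the three syntactic guards of `D'` are
certified load-bearing — each mutation makes `D'` hold for EVERY `z`, so the heart would force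
`H = ℓ H + GT`, hence (the line's own Krull funnel `…_genericallyTorsion_of_forall_pow`, landed
p150537) `H = GT`, hence `N¹H⁴ = H⁴` (bridge `GT ⊗ ℂ ⊆ N¹` + integral classes span), contradiction:

* `stub_finiteLevel_false_without_oneLeM`   — `1 ≤ M` dropped (`M = 0`, `Z = ∅`, `y = 0`);
* `stub_finiteLevel_false_without_neUniv`   — `Z ≠ univ` dropped (`Z = X`: `(X∖X)(ℂ) = ∅`);
* `stub_finiteLevel_false_without_isClosed` — `IsClosed Z` dropped (`Z = X ∖ {η}`: no complex point
  lies over the generic point of `(E_τ × E_τ)²`, `pt_ne_genericPoint_of_ne`).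
So any proof of the heart must USE that `D'` sees a genuine non-empty Zariski open and a torsion
multiplier `M ≥ 1`; and the funnel direction "clean ⇒ everything generically torsion" is exactly as
strong as `N¹ = ⊤`, which fails on `(E_τ × E_τ)²`. Sorry-free, definition-free; no named fact assumed.

References: [BlochOgus1974ENS] (3.8); [Dimca1992] Ch. 1 Cor. (6.10); [VoisinHodgeI2002] Thm. 11.38;
[GrothendieckTopology1969] p. 300; [HatcherAT2002] §3.1.
-/

noncomputable section

-- The mandated namespace `Summit.<P>.<Sub>.Theorems.…` repeats `HodgeConjecture` (single-conjunct summit).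
set_option linter.dupNamespace false

open CategoryTheory AlgebraicGeometry

namespace Summit.HodgeConjecture.HodgeConjecture.Theorems.GenericDivisibilityBounded.Negative.HeartLoadBearing

open Literature.AlgebraicGeometry.Motives Literature.AlgebraicGeometry.HodgeTheory
  Literature.AlgebraicTopology.SingularHomology
open Summit.HodgeConjecture.HodgeConjecture.Theorems
open Summit.HodgeConjecture.HodgeConjecture.Theorems.GenericDivisibilityBounded.Negative.ConiveauZeroWitness
open Summit.HodgeConjecture.HodgeConjecture.Theorems.GenericDivisibilityBounded.Negative.ArenaNonempty
open WeilSquare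

/-- Restriction `H^k(X(ℂ);ℤ) → H^k((X∖Z)(ℂ);ℤ)`, the very term of the route decls (notation only). -/
local notation3 (prettyPrint := false) "Res[" X ", " Z ", " k "]" =>
  singularCohomology.map ℤ ℤ
    (⟨Subtype.val, continuous_subtype_val⟩ : C(complexPointsCompl X Z, ComplexPoints X)) k

/-! ### The funnel direction: "`z - ℓ w ∈ GT` for every `z`" forces `GT = H`, i.e. `N¹ = ⊤` -/

/-- **If every class is `≡ ℓ •(something)` modulo `GT` (`ℓ ≥ 2`), every class is in `GT`**:
iterate (`GT` is a subgroup stable under `ℕ`-multiples) to get `z ≡ ℓ^{n+1} wₙ (mod GT)` for all `n`,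
then the line's Krull funnel (`H` finitely generated, `GT` saturated). [cite: BlochOgus1974ENS, (3.8)] -/
theorem genericallyTorsion_of_forall_exists_sub_smul {n₀ : ℕ} {X : SchemeOver ℂ}
    (hX : IsSmoothProjective n₀ X) {k ℓ : ℕ} (hℓ : 2 ≤ ℓ)
    (h : ∀ z : singularCohomology ℤ ℤ (ComplexPoints X) k,
      ∃ w : singularCohomology ℤ ℤ (ComplexPoints X) k, ∃ Z : Set X.left, IsClosed Z ∧ Z ≠ Set.univ ∧
        ∃ N : ℕ, 1 ≤ N ∧ N • Res[X, Z, k] (z - ℓ • w) = 0)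
    (z : singularCohomology ℤ ℤ (ComplexPoints X) k) :
    ∃ Z : Set X.left, IsClosed Z ∧ Z ≠ Set.univ ∧ ∃ N : ℕ, 1 ≤ N ∧ N • Res[X, Z, k] z = 0 := by
  haveI := hX.geometricallyIrreducible
  haveI : IrreducibleSpace X.left := GeometricallyIrreducible.irreducibleSpace_of_subsingleton X.hom
  refine genericDivisibilityBounded_genericallyTorsion_of_forall_pow hX hℓ fun n ↦ ?_
  induction n with
  | zero =>
    obtain ⟨w, hw⟩ := h z
    exact ⟨w, by simpa only [zero_add, pow_one] using hw⟩
  | succ n ih =>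
    obtain ⟨w, hw⟩ := ih
    obtain ⟨w', hw'⟩ := h w
    refine ⟨w', ?_⟩
    have hid : z - ℓ ^ (n + 1 + 1) • w' = (z - ℓ ^ (n + 1) • w) + ℓ ^ (n + 1) • (w - ℓ • w') := by
      rw [smul_sub, ← mul_smul, ← pow_succ]; abel
    rw [hid]
    exact genericDivisibilityBounded_genericallyTorsion_add hw
      (genericDivisibilityBounded_genericallyTorsion_nsmul _ hw')

/-- **… hence `N¹Hᵏ(X(ℂ); ℂ) = Hᵏ`** (bridge `GT ⊗ ℂ ⊆ N¹`; the integral classes span `Hᵏ(X(ℂ); ℂ)`).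
[cite: HatcherAT2002, §3.1 Thm. 3.2] [cite: VoisinHodgeI2002, §11.3] -/
theorem supportedClasses_eq_top_of_forall_exists_sub_smul {n₀ : ℕ} {X : SchemeOver ℂ}
    (hX : IsSmoothProjective n₀ X) {k ℓ : ℕ} (hℓ : 2 ≤ ℓ)
    (h : ∀ z : singularCohomology ℤ ℤ (ComplexPoints X) k,
      ∃ w : singularCohomology ℤ ℤ (ComplexPoints X) k, ∃ Z : Set X.left, IsClosed Z ∧ Z ≠ Set.univ ∧
        ∃ N : ℕ, 1 ≤ N ∧ N • Res[X, Z, k] (z - ℓ • w) = 0) :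
    supportedClasses X k 1 = ⊤ := by
  by_contra hne
  obtain ⟨z, hz⟩ := exists_ringChange_not_mem_of_ne_top hX hne
  exact hz (genericDivisibilityBounded_ringChange_mem_supportedClasses hX
    (genericallyTorsion_of_forall_exists_sub_smul hX hℓ h z))

/-! ### No complex point over the generic point of `(E_τ × E_τ)²` -/

/-- On a smooth projective `X` with two distinct complex points, no complex point lies over the generic
point (complex points are closed points, `ComplexPoints.isClosed_pt`; a closed generic point makes the
space a singleton; `ComplexPoints.ext_of_pt_eq`). [folklore] -/
theorem pt_ne_genericPoint_of_ne {n : ℕ} {X : SchemeOver ℂ} [IrreducibleSpace X.left]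
    (hX : IsSmoothProjective n X) {P Q : ComplexPoints X} (hPQ : P ≠ Q) (R : ComplexPoints X) :
    R.pt ≠ genericPoint X.left := by
  haveI := hX.smoothOfRelativeDimension
  haveI : Smooth X.hom := SmoothOfRelativeDimension.smooth n _
  haveI : LocallyOfFiniteType X.hom := inferInstance
  intro h
  have hcl := ComplexPoints.isClosed_pt R
  have hall : ∀ y : X.left, y = R.pt := fun y ↦ by
    have hy : y ∈ closure {genericPoint X.left} := by
      rw [(genericPoint_spec _).def]; trivial
    rw [← h, hcl.closure_eq] at hy
    exact hy
  exact hPQ (ComplexPoints.ext_of_pt_eq ((hall _).trans (hall _).symm))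

/-- `(E_τ × E_τ)²` has two distinct complex points. [folklore] -/
theorem exists_ne_complexPoints_squareProd (τ : ℂ) (hτ : τ.im ≠ 0) :
    ∃ P Q : ComplexPoints ((square τ hτ).prod (square τ hτ)).X, P ≠ Q := by
  refine ⟨AlgPoints.prodEquiv.symm (sqMap τ hτ 0, sqMap τ hτ 0),
    AlgPoints.prodEquiv.symm (sqMap τ hτ ![1 / 2, 0], sqMap τ hτ 0), fun h ↦ ?_⟩
  have h1 := congrArg Prod.fst (AlgPoints.prodEquiv.symm.injective h)
  have h0 := (sqMap_eq_sqMap_iff τ hτ).1 h1 0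
  simp only [Pi.zero_apply, Matrix.cons_val_zero, zero_sub, neg_mem_iff] at h0
  exact one_half_not_mem_lattice τ hτ h0

/-! ### The three load-bearing lemmas for the heart -/

/-- **`1 ≤ M` in `D'` is load-bearing for the heart**: with `M = 0` allowed, `D'(ℓ^s, z)` holds for
every `z` (`Z = ∅`, `y = 0`), so the heart would give `z - ℓ • w ∈ GT` for all `z`, i.e. `N¹H⁴ = H⁴`
on the fourfold `(E_i × E_i)²` — false (`ArenaNonempty`). [cite: GrothendieckTopology1969, p. 300] -/
theorem stub_finiteLevel_false_without_oneLeM :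
    ¬ (∀ ⦃p : ℕ⦄ ⦃X : SchemeOver ℂ⦄, 2 ≤ p → IsSmoothProjective (2 * p) X →
      ∃ ℓ s : ℕ, ℓ.Prime ∧ 1 ≤ s ∧
        ∀ z : singularCohomology ℤ ℤ (ComplexPoints X) (2 * p),
          (∃ Z : Set X.left, IsClosed Z ∧ Z ≠ Set.univ ∧
            ∃ (y : singularCohomology ℤ ℤ (complexPointsCompl X Z) (2 * p)) (M : ℕ),
              M • (Res[X, Z, 2 * p] z - ℓ ^ s • y) = 0) →
          ∃ w : singularCohomology ℤ ℤ (ComplexPoints X) (2 * p),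
            ∃ Z : Set X.left, IsClosed Z ∧ Z ≠ Set.univ ∧ ∃ N : ℕ, 1 ≤ N ∧
              N • Res[X, Z, 2 * p] (z - ℓ • w) = 0) := by
  intro h
  obtain ⟨X, hX, hne⟩ := exists_fourfold_offSupportedTop
  haveI := hX.geometricallyIrreducible
  haveI : IrreducibleSpace X.left := GeometricallyIrreducible.irreducibleSpace_of_subsingleton X.hom
  obtain ⟨ℓ, s, hℓ, -, hclean⟩ := h (p := 2) le_rfl hX
  refine hne (supportedClasses_eq_top_of_forall_exists_sub_smul hX hℓ.two_le fun z ↦ hclean z ?_)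
  exact ⟨∅, isClosed_empty, Set.empty_ne_univ, 0, 0, by rw [zero_smul]⟩

/-- **`Z ≠ univ` in `D'` is load-bearing for the heart**: with the empty open allowed, `z|_{(X∖X)(ℂ)} = 0`
and `D'` holds for every `z` (`y = 0`, `M = 1`); conclude as before on `(E_i × E_i)²`.
[cite: GrothendieckTopology1969, p. 300] -/
theorem stub_finiteLevel_false_without_neUniv :
    ¬ (∀ ⦃p : ℕ⦄ ⦃X : SchemeOver ℂ⦄, 2 ≤ p → IsSmoothProjective (2 * p) X →
      ∃ ℓ s : ℕ, ℓ.Prime ∧ 1 ≤ s ∧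
        ∀ z : singularCohomology ℤ ℤ (ComplexPoints X) (2 * p),
          (∃ Z : Set X.left, IsClosed Z ∧
            ∃ (y : singularCohomology ℤ ℤ (complexPointsCompl X Z) (2 * p)) (M : ℕ), 1 ≤ M ∧
              M • (Res[X, Z, 2 * p] z - ℓ ^ s • y) = 0) →
          ∃ w : singularCohomology ℤ ℤ (ComplexPoints X) (2 * p),
            ∃ Z : Set X.left, IsClosed Z ∧ Z ≠ Set.univ ∧ ∃ N : ℕ, 1 ≤ N ∧
              N • Res[X, Z, 2 * p] (z - ℓ • w) = 0) := by
  intro h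
  obtain ⟨X, hX, hne⟩ := exists_fourfold_offSupportedTop
  obtain ⟨ℓ, s, hℓ, -, hclean⟩ := h (p := 2) le_rfl hX
  refine hne (supportedClasses_eq_top_of_forall_exists_sub_smul hX hℓ.two_le fun z ↦ hclean z ?_)
  haveI : IsEmpty (complexPointsCompl X Set.univ) := ⟨fun P ↦ P.2 (Set.mem_univ _)⟩
  haveI := ModuleCat.subsingleton_of_isZero
    (isZero_singularCohomology_of_isEmpty ℤ ℤ (E := complexPointsCompl X Set.univ) (2 * 2))
  exact ⟨Set.univ, isClosed_univ, 0, 1, le_rfl, Subsingleton.elim _ _⟩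

/-- **`IsClosed Z` in `D'` is load-bearing for the heart**: on `(E_i × E_i)²` the non-closed
`Z = X ∖ {η}` is `≠ univ` but `(X ∖ Z)(ℂ) = ∅` (no complex point over the generic point), so again
`D'` holds for every `z`. [cite: GrothendieckTopology1969, p. 300] -/
theorem stub_finiteLevel_false_without_isClosed :
    ¬ (∀ ⦃p : ℕ⦄ ⦃X : SchemeOver ℂ⦄, 2 ≤ p → IsSmoothProjective (2 * p) X →
      ∃ ℓ s : ℕ, ℓ.Prime ∧ 1 ≤ s ∧
        ∀ z : singularCohomology ℤ ℤ (ComplexPoints X) (2 * p),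
          (∃ Z : Set X.left, Z ≠ Set.univ ∧
            ∃ (y : singularCohomology ℤ ℤ (complexPointsCompl X Z) (2 * p)) (M : ℕ), 1 ≤ M ∧
              M • (Res[X, Z, 2 * p] z - ℓ ^ s • y) = 0) →
          ∃ w : singularCohomology ℤ ℤ (ComplexPoints X) (2 * p),
            ∃ Z : Set X.left, IsClosed Z ∧ Z ≠ Set.univ ∧ ∃ N : ℕ, 1 ≤ N ∧
              N • Res[X, Z, 2 * p] (z - ℓ • w) = 0) := by
  intro h
  have hI : Complex.I.im ≠ 0 := by simp
  have hX : IsSmoothProjective (2 * 2) ((square Complex.I hI).prod (square Complex.I hI)).X :=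
    isSmoothProjective_squareProd Complex.I hI
  obtain ⟨P, Q, hPQ⟩ := exists_ne_complexPoints_squareProd Complex.I hI
  obtain ⟨ℓ, s, hℓ, -, hclean⟩ := h (p := 2) le_rfl hX
  refine supportedClasses_squareProd_four_one_ne_top Complex.I hI
    (supportedClasses_eq_top_of_forall_exists_sub_smul hX hℓ.two_le fun z ↦ hclean z ?_)
  set X := ((square Complex.I hI).prod (square Complex.I hI)).X with hXdef
  refine ⟨{genericPoint X.left}ᶜ, fun hu ↦ ?_, ?_⟩
  · have hmem : genericPoint X.left ∈ ({genericPoint X.left}ᶜ : Set X.left) := hu ▸ Set.mem_univ _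
    exact hmem rfl
  · haveI : IsEmpty (complexPointsCompl X {genericPoint X.left}ᶜ) :=
      ⟨fun R ↦ R.2 (fun hR ↦ pt_ne_genericPoint_of_ne hX hPQ R.1 hR)⟩
    haveI := ModuleCat.subsingleton_of_isZero
      (isZero_singularCohomology_of_isEmpty ℤ ℤ (E := complexPointsCompl X {genericPoint X.left}ᶜ) (2 * 2))
    exact ⟨0, 1, le_rfl, Subsingleton.elim _ _⟩

end Summit.HodgeConjecture.HodgeConjecture.Theorems.GenericDivisibilityBounded.Negative.HeartLoadBearing

end
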